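import Literature.AlgebraicGeometry.Hu2025.Proofs.S03Pluecker.Prop36Minors
import Literature.AlgebraicGeometry.Hu2025.Proofs.S03Pluecker.KeyTrick
import Mathlib.Tactic.IntervalCases
import HarnessLib

/-!
# Hu 2025 §3.3 Proposition 3.6 — DISCHARGE AS TYPED, part 2: `Prop3_6_1_holds`, `Prop3_6_2_holds`, `Prop3_6_holds` (row 101b, typer res-type-009)

Continuation of `Prop36Minors.lean` (toolkit + the minors of `[I₃ | A]` in closed form). **HONEST FRAMING (D-0012/D-0089)** as there: theorems
about OUR typed transcription (RING-LEVEL READING of «𝕌 ∩ Gr^{3,E}» via `chartParam`); the preprint [Hu2025] stays «under review»; AI proof is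
weaker than expert review; nothing here is progress on resolution of singularities.

§3 `chartParam` kills every `F̄_{m,u}` (`chartParam_primaryRelBar`, `span_primaryFamily_le_ker`) · §4 `chartParam ∘ basicIncl = id`, `x_u ≡ basicIncl
(chartParam x_u) mod (𝓕_m)` (basic: trivially; rank 0: the difference IS `F̄_{m,u}` — printed proof p0018 l.102–106; rank 1: `F̄_{abc} + x_{12a}F̄_{3bc} −
x_{13a}F̄_{2bc} + x_{23a}F̄_{1bc}` by the cofactor expansion — printed proof l.108–123), hence `f − basicIncl (chartParam f) ∈ (𝓕_m)` for all `f` ·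
§5 the three `_holds` (every `n`, every commutative `k`).
-/

noncomputable section

namespace Literature.AlgebraicGeometry.Hu2025.Statements.S03Pluecker

open MvPolynomial

universe u

variable {n : ℕ} (k : Type u) [CommRing k]

/-! ## §3 `chartParam` kills the primary relations: `(𝓕_m) ⊆ ker chartParam` -/

/-- Unfolding `F̄_{m,u}` on the four index shapes (as sums over row 101a's term list).
[cite: Hu2025, Prop. 3.6, p.38 l.11–19 (unrefereed preprint arXiv:2507.21400v1 under adjudication, D-0012/D-0089
— kernel support on OUR typed carriers of row 101; nothing of the source asserted)] -/
theorem primaryRelBar_eq (u : ℕ × ℕ × ℕ) (hlt : IsLt u) :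
    primaryRelBar n k u =
      if u.1 = 1 then xbar k u * xbar k mTri - xbar k (1, 2, u.2.1) * xbar k (1, 3, u.2.2) + xbar k (1, 3, u.2.1) * xbar k (1, 2, u.2.2)
      else if u.1 = 2 then xbar k u * xbar k mTri - xbar k (1, 2, u.2.1) * xbar k (2, 3, u.2.2) + xbar k (2, 3, u.2.1) * xbar k (1, 2, u.2.2)
      else if u.1 = 3 then xbar k u * xbar k mTri - xbar k (1, 3, u.2.1) * xbar k (2, 3, u.2.2) + xbar k (2, 3, u.2.1) * xbar k (1, 3, u.2.2)
      else xbar k u * xbar k mTri - xbar k (1, 2, u.1) * xbar k (3, u.2.1, u.2.2) + xbar k (1, 3, u.1) * xbar k (2, u.2.1, u.2.2)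
        - xbar k (2, 3, u.1) * xbar k (1, u.2.1, u.2.2) := by
  unfold primaryRelBar primaryTerms
  rw [if_pos hlt]
  split_ifs <;> simp only [List.map, List.sum_cons, List.sum_nil] <;> push_cast <;> ring

/-- **`chartParam (F̄_{m,u}) = 0`**: the `3 × 3` minors of `[I₃ | A]` satisfy every m-primary relation (four cases; the rank-1 case is the
cofactor expansion `chartMinor_abc`).
[cite: Hu2025, Prop. 3.6, p.38 l.11–19 (unrefereed preprint arXiv:2507.21400v1 under adjudication, D-0012/D-0089
— kernel support on OUR typed carriers of row 101; nothing of the source asserted)] -/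
theorem chartParam_primaryRelBar (u : ℕ × ℕ × ℕ) (hu : u ∈ plIndexSet n) (hlt : IsLt u) :
    chartParam n k (primaryRelBar n k u) = 0 := by
  have h3 := three_lt_of_isLt (n := n) hu hlt
  obtain ⟨u₁, u₂, u₃⟩ := u
  rw [mem_plIndexSet_iff] at hu
  simp only at hu h3
  obtain ⟨⟨h1a, h1b⟩, ⟨⟨h2a, h2b⟩, ⟨h3a, h3b⟩⟩, h12, h23⟩ := hu
  have M : ∀ a b c : ℕ, 1 ≤ a → a < b → b < c → c ≤ n → 3 < c →
      chartParam n k (xbar k (a, b, c)) = chartMinor k (a, b, c) :=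
    fun a b c ha hab hbc hc h3c => chartParam_xbar k (mem_plVarSet ha hab hbc hc h3c)
  have hu3 : 3 < u₃ := by omega
  rw [primaryRelBar_eq k _ hlt]
  simp only
  by_cases e1 : u₁ = 1
  · subst e1
    rw [if_pos rfl]
    simp only [map_add, map_sub, map_mul, chartParam_xbar_mTri]
    rw [M 1 u₂ u₃ (by norm_num) h12 h23 h3b hu3, M 1 2 u₂ (by norm_num) (by norm_num) (by omega) h2b h3,
      M 1 3 u₃ (by norm_num) (by norm_num) hu3 h3b hu3, M 1 3 u₂ (by norm_num) (by norm_num) h3 h2b h3,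
      M 1 2 u₃ (by norm_num) (by norm_num) (by omega) h3b hu3,
      chartMinor_1bc k h3 hu3, chartMinor_12a k h3, chartMinor_13a k hu3, chartMinor_13a k h3, chartMinor_12a k hu3]
    ring
  by_cases e2 : u₁ = 2
  · subst e2
    rw [if_neg (by decide), if_pos rfl]
    simp only [map_add, map_sub, map_mul, chartParam_xbar_mTri]
    rw [M 2 u₂ u₃ (by norm_num) h12 h23 h3b hu3, M 1 2 u₂ (by norm_num) (by norm_num) (by omega) h2b h3,
      M 2 3 u₃ (by norm_num) (by norm_num) hu3 h3b hu3, M 2 3 u₂ (by norm_num) (by norm_num) h3 h2b h3,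
      M 1 2 u₃ (by norm_num) (by norm_num) (by omega) h3b hu3,
      chartMinor_2bc k h3 hu3, chartMinor_12a k h3, chartMinor_23a k hu3, chartMinor_23a k h3, chartMinor_12a k hu3]
    ring
  by_cases e3 : u₁ = 3
  · subst e3
    rw [if_neg (by decide), if_neg (by decide), if_pos rfl]
    simp only [map_add, map_sub, map_mul, chartParam_xbar_mTri]
    rw [M 3 u₂ u₃ (by norm_num) h12 h23 h3b hu3, M 1 3 u₂ (by norm_num) (by norm_num) h3 h2b h3,
      M 2 3 u₃ (by norm_num) (by norm_num) hu3 h3b hu3, M 2 3 u₂ (by norm_num) (by norm_num) h3 h2b h3,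
      M 1 3 u₃ (by norm_num) (by norm_num) hu3 h3b hu3,
      chartMinor_3bc k h3 hu3, chartMinor_13a k h3, chartMinor_23a k hu3, chartMinor_23a k h3, chartMinor_13a k hu3]
    ring
  · have h4 : 3 < u₁ := by omega
    rw [if_neg e1, if_neg e2, if_neg e3]
    simp only [map_add, map_sub, map_mul, chartParam_xbar_mTri]
    rw [M u₁ u₂ u₃ h1a h12 h23 h3b hu3, M 1 2 u₁ (by norm_num) (by norm_num) (by omega) h1b h4,
      M 3 u₂ u₃ (by norm_num) h3 h23 h3b hu3, M 1 3 u₁ (by norm_num) (by norm_num) h4 h1b h4,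
      M 2 u₂ u₃ (by norm_num) (by omega) h23 h3b hu3, M 2 3 u₁ (by norm_num) (by norm_num) h4 h1b h4,
      M 1 u₂ u₃ (by norm_num) (by omega) h23 h3b hu3,
      chartMinor_abc k h4 h3 hu3, chartMinor_12a k h4, chartMinor_13a k h4, chartMinor_23a k h4]
    ring

/-- **`(𝓕_m) ⊆ ker chartParam`.**
[cite: Hu2025, Prop. 3.6, p.38 l.11–19 (unrefereed preprint arXiv:2507.21400v1 under adjudication, D-0012/D-0089
— kernel support on OUR typed carriers of row 101; nothing of the source asserted)] -/
theorem span_primaryFamily_le_ker :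
    Ideal.span (primaryFamily n k) ≤ RingHom.ker (chartParam n k).toRingHom := by
  rw [Ideal.span_le]
  rintro F ⟨u, hlt, rfl⟩
  rw [SetLike.mem_coe, RingHom.mem_ker]
  exact chartParam_primaryRelBar k u.1 u.2 hlt

/-! ## §4 `chartParam ∘ basicIncl = id` and `x_u ≡ basicIncl (chartParam x_u)` modulo `(𝓕_m)` -/

/-- A basic index is `(1,2,a)`, `(1,3,a)` or `(2,3,a)` with `a > 3`.
[cite: Hu2025, Prop. 3.6, p.38 l.11–19 (unrefereed preprint arXiv:2507.21400v1 under adjudication, D-0012/D-0089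
— kernel support on OUR typed carriers of row 101; nothing of the source asserted)] -/
theorem basic_cases {t : ℕ × ℕ × ℕ} (h : t ∈ plVarSet n) (hb : ¬ IsLt t) :
    3 < t.2.2 ∧ t.2.2 ≤ n ∧ (t = (1, 2, t.2.2) ∨ t = (1, 3, t.2.2) ∨ t = (2, 3, t.2.2)) := by
  obtain ⟨t₁, t₂, t₃⟩ := t
  have hm : (t₁, t₂, t₃) ≠ mTri := (Finset.mem_erase.mp h).1
  have ht := (Finset.mem_erase.mp h).2
  rw [mem_plIndexSet_iff] at ht
  simp only at ht ⊢
  have h2 : t₂ ≤ 3 := by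
    by_contra hlt
    exact hb (isLt_of_lt (a := t₁) (by omega) ht.2.2.2)
  have h3 : 3 < t₃ := by
    by_contra hle
    apply hm
    unfold mTri
    simp only [Prod.mk.injEq]
    omega
  refine ⟨h3, ht.2.1.2.2, ?_⟩
  simp only [Prod.mk.injEq, and_true]
  omega

/-- The minor at a basic index is the basic variable itself.
[cite: Hu2025, Prop. 3.6, p.38 l.11–19 (unrefereed preprint arXiv:2507.21400v1 under adjudication, D-0012/D-0089
— kernel support on OUR typed carriers of row 101; nothing of the source asserted)] -/
theorem chartMinor_basic {t : ℕ × ℕ × ℕ} (h : t ∈ plVarSet n) (hb : ¬ IsLt t) :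
    (chartMinor k t : BasicRing n k) = bvar k t := by
  obtain ⟨h3, -, ht⟩ := basic_cases (n := n) h hb
  rcases ht with ht | ht | ht <;> rw [ht]
  · exact chartMinor_12a k h3
  · exact chartMinor_13a k h3
  · exact chartMinor_23a k h3

/-- **`chartParam ∘ basicIncl = id`** on `k[Var_𝕌]`.
[cite: Hu2025, Prop. 3.6, p.38 l.11–19 (unrefereed preprint arXiv:2507.21400v1 under adjudication, D-0012/D-0089
— kernel support on OUR typed carriers of row 101; nothing of the source asserted)] -/
theorem chartParam_comp_basicIncl : (chartParam n k).comp (basicIncl n k) = AlgHom.id k (BasicRing n k) := by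
  refine MvPolynomial.algHom_ext fun x => ?_
  obtain ⟨⟨t, h⟩, hb⟩ := x
  rw [AlgHom.comp_apply, AlgHom.id_apply]
  unfold basicIncl
  rw [rename_X]
  change chartParam n k (X (⟨t, h⟩ : plVar n)) = _
  unfold chartParam
  rw [aeval_X]
  change chartMinor k t = _
  rw [chartMinor_basic k h hb, bvar_of_mem k h hb]

/-- `chartParam (basicIncl b) = b`.
[cite: Hu2025, Prop. 3.6, p.38 l.11–19 (unrefereed preprint arXiv:2507.21400v1 under adjudication, D-0012/D-0089
— kernel support on OUR typed carriers of row 101; nothing of the source asserted)] -/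
theorem chartParam_basicIncl (b : BasicRing n k) : chartParam n k (basicIncl n k b) = b := by
  have := congrArg (fun φ => φ b) (chartParam_comp_basicIncl (n := n) k)
  simpa using this

/-- `F̄_{m,u} ∈ (𝓕_m)` for `u ∈ 𝕀^lt`.
[cite: Hu2025, Prop. 3.6, p.38 l.11–19 (unrefereed preprint arXiv:2507.21400v1 under adjudication, D-0012/D-0089
— kernel support on OUR typed carriers of row 101; nothing of the source asserted)] -/
theorem primaryRelBar_mem_span {u : ℕ × ℕ × ℕ} (hu : u ∈ plIndexSet n) (hlt : IsLt u) :
    primaryRelBar n k u ∈ Ideal.span (primaryFamily n k) :=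
  Ideal.subset_span ⟨⟨u, hu⟩, hlt, rfl⟩

/-- Rank-0 step of the printed proof (p0018 l.102–106): for `u = (i,b,c)`, `i ≤ 3 < b`, `x_u − basicIncl (chartMinor u) = F̄_{m,u}`.
[cite: Hu2025, Prop. 3.6, p.38 l.11–19 (unrefereed preprint arXiv:2507.21400v1 under adjudication, D-0012/D-0089
— kernel support on OUR typed carriers of row 101; nothing of the source asserted)] -/
theorem X_sub_incl_chartMinor_rank0 {i b c : ℕ} (hi : 1 ≤ i) (hi3 : i ≤ 3) (hb : 3 < b) (hbc : b < c) (hc : c ≤ n) :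
    (xbar k (i, b, c) : ChartRing n k) - basicIncl n k (chartMinor k (i, b, c)) = primaryRelBar n k (i, b, c) := by
  have hlt : IsLt (i, b, c) := isLt_of_lt hb hbc
  have hc3 : 3 < c := by omega
  have hbn : b ≤ n := by omega
  have B : ∀ a b' c' : ℕ, 1 ≤ a → a < b' → b' ≤ 3 → b' < c' → c' ≤ n → 3 < c' →
      basicIncl n k (bvar k (a, b', c')) = xbar k (a, b', c') :=
    fun a b' c' ha hab hb3 hbc' hc' h3c => basicIncl_bvar k (mem_plVarSet ha hab hbc' hc' h3c) (not_isLt_of_le ha hab hb3)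
  rw [primaryRelBar_eq k _ hlt, xbar_mTri]
  simp only
  interval_cases i
  · rw [if_pos rfl, chartMinor_1bc k hb hc3]
    simp only [map_sub, map_mul]
    rw [B 1 2 b (by norm_num) (by norm_num) (by norm_num) (by omega) hbn hb, B 1 3 c (by norm_num) (by norm_num) le_rfl hc3 hc hc3,
      B 1 3 b (by norm_num) (by norm_num) le_rfl hb hbn hb, B 1 2 c (by norm_num) (by norm_num) (by norm_num) (by omega) hc hc3]
    ring
  · rw [if_neg (by decide), if_pos rfl, chartMinor_2bc k hb hc3]
    simp only [map_sub, map_mul]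
    rw [B 1 2 b (by norm_num) (by norm_num) (by norm_num) (by omega) hbn hb, B 2 3 c (by norm_num) (by norm_num) le_rfl hc3 hc hc3,
      B 2 3 b (by norm_num) (by norm_num) le_rfl hb hbn hb, B 1 2 c (by norm_num) (by norm_num) (by norm_num) (by omega) hc hc3]
    ring
  · rw [if_neg (by decide), if_neg (by decide), if_pos rfl, chartMinor_3bc k hb hc3]
    simp only [map_sub, map_mul]
    rw [B 1 3 b (by norm_num) (by norm_num) le_rfl hb hbn hb, B 2 3 c (by norm_num) (by norm_num) le_rfl hc3 hc hc3,
      B 2 3 b (by norm_num) (by norm_num) le_rfl hb hbn hb, B 1 3 c (by norm_num) (by norm_num) le_rfl hc3 hc hc3]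
    ring

/-- **`x_t − basicIncl (chartParam x_t) ∈ (𝓕_m)` for every chart variable** (basic: `0`; rank 0: `F̄_{m,t}`; rank 1, the second round of the
printed proof p0018 l.108–123: `F̄_{abc} + x_{12a}F̄_{3bc} − x_{13a}F̄_{2bc} + x_{23a}F̄_{1bc}` by the cofactor expansion).
[cite: Hu2025, Prop. 3.6, p.38 l.11–19 (unrefereed preprint arXiv:2507.21400v1 under adjudication, D-0012/D-0089
— kernel support on OUR typed carriers of row 101; nothing of the source asserted)] -/
theorem X_sub_incl_chartParam_mem (x : plVar n) :
    (X x : ChartRing n k) - basicIncl n k (chartParam n k (X x)) ∈ Ideal.span (primaryFamily n k) := by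
  obtain ⟨t, h⟩ := x
  unfold chartParam
  rw [aeval_X]
  change (X (⟨t, h⟩ : plVar n) : ChartRing n k) - basicIncl n k (chartMinor k t) ∈ _
  rw [← xbar_of_mem k h]
  by_cases hb : IsLt t
  swap
  · rw [chartMinor_basic k h hb, basicIncl_bvar k h hb, sub_self]
    exact Ideal.zero_mem _
  have ht := (Finset.mem_erase.mp h).2
  have h3 := three_lt_of_isLt (n := n) ht hb
  obtain ⟨t₁, t₂, t₃⟩ := t
  rw [mem_plIndexSet_iff] at ht
  simp only at ht h3
  obtain ⟨⟨h1a, h1b⟩, ⟨⟨h2a, h2b⟩, ⟨h3a, h3b⟩⟩, h12, h23⟩ := ht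
  by_cases h4 : t₁ ≤ 3
  · rw [X_sub_incl_chartMinor_rank0 k h1a h4 h3 h23 h3b]
    exact primaryRelBar_mem_span k (mem_plIndexSet h1a h12 h23 h3b) hb
  · have h4' : 3 < t₁ := by omega
    -- the rank-1 index `(a,b,c) = (t₁,t₂,t₃)`
    have hu3 : 3 < t₃ := by omega
    have B : ∀ a b' : ℕ, 1 ≤ a → a < b' → b' ≤ 3 → basicIncl n k (bvar k (a, b', t₁)) = xbar k (a, b', t₁) :=
      fun a b' ha hab hb3 => basicIncl_bvar k (mem_plVarSet ha hab (by omega) h1b h4') (not_isLt_of_le ha hab hb3)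
    have e : (xbar k (t₁, t₂, t₃) : ChartRing n k) - basicIncl n k (chartMinor k (t₁, t₂, t₃)) =
        primaryRelBar n k (t₁, t₂, t₃) + xbar k (1, 2, t₁) * primaryRelBar n k (3, t₂, t₃)
          - xbar k (1, 3, t₁) * primaryRelBar n k (2, t₂, t₃) + xbar k (2, 3, t₁) * primaryRelBar n k (1, t₂, t₃) := by
      rw [← X_sub_incl_chartMinor_rank0 k (i := 3) (b := t₂) (c := t₃) (by norm_num) le_rfl h3 h23 h3b,
        ← X_sub_incl_chartMinor_rank0 k (i := 2) (b := t₂) (c := t₃) (by norm_num) (by norm_num) h3 h23 h3b,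
        ← X_sub_incl_chartMinor_rank0 k (i := 1) (b := t₂) (c := t₃) (by norm_num) (by norm_num) h3 h23 h3b,
        primaryRelBar_eq k _ hb]
      simp only
      rw [if_neg (by omega), if_neg (by omega), if_neg (by omega), xbar_mTri, chartMinor_abc k h4' h3 hu3]
      simp only [map_add, map_sub, map_mul]
      rw [B 1 2 (by norm_num) (by norm_num) (by norm_num), B 1 3 (by norm_num) (by norm_num) le_rfl, B 2 3 (by norm_num) (by norm_num) le_rfl]
      ring
    rw [e]
    refine Ideal.add_mem _ (Ideal.sub_mem _ (Ideal.add_mem _ ?_ (Ideal.mul_mem_left _ _ ?_)) (Ideal.mul_mem_left _ _ ?_))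
      (Ideal.mul_mem_left _ _ ?_)
    · exact primaryRelBar_mem_span k (mem_plIndexSet h1a h12 h23 h3b) hb
    · exact primaryRelBar_mem_span k (mem_plIndexSet (by norm_num) h3 h23 h3b) (isLt_of_lt h3 h23)
    · exact primaryRelBar_mem_span k (mem_plIndexSet (by norm_num) (by omega) h23 h3b) (isLt_of_lt h3 h23)
    · exact primaryRelBar_mem_span k (mem_plIndexSet (by norm_num) (by omega) h23 h3b) (isLt_of_lt h3 h23)

/-- **`f ≡ basicIncl (chartParam f)` modulo `(𝓕_m)` for every `f ∈ k[x_u]`** (the two algebra maps `k[x_u] → k[x_u]/(𝓕_m)` agree on the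
variables).
[cite: Hu2025, Prop. 3.6, p.38 l.11–19 (unrefereed preprint arXiv:2507.21400v1 under adjudication, D-0012/D-0089
— kernel support on OUR typed carriers of row 101; nothing of the source asserted)] -/
theorem sub_incl_chartParam_mem (f : ChartRing n k) :
    f - basicIncl n k (chartParam n k f) ∈ Ideal.span (primaryFamily n k) := by
  set I := Ideal.span (primaryFamily n k)
  have hφ : (Ideal.Quotient.mkₐ k I).comp ((basicIncl n k).comp (chartParam n k)) = Ideal.Quotient.mkₐ k I := by
    refine MvPolynomial.algHom_ext fun x => ?_
    simp only [AlgHom.comp_apply, Ideal.Quotient.mkₐ_eq_mk]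
    rw [Ideal.Quotient.eq]
    have h := X_sub_incl_chartParam_mem (n := n) k x
    rw [← Ideal.neg_mem_iff, neg_sub] at h
    exact h
  have h := congrArg (fun φ => φ f) hφ
  simp only [AlgHom.comp_apply, Ideal.Quotient.mkₐ_eq_mk] at h
  rw [Ideal.Quotient.eq] at h
  rw [← Ideal.neg_mem_iff, neg_sub]
  exact h

/-! ## §5 The discharges -/

/-- **`Prop3_6_2` HOLDS** (second sentence of Prop 3.6 as typed): `k[Var_𝕌] → k[x_u]/(𝓕_m)` is bijective.
[cite: Hu2025, Prop. 3.6, p.38 l.11–19 (unrefereed preprint arXiv:2507.21400v1 under adjudication, D-0012/D-0089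
— kernel support on OUR typed carriers of row 101; nothing of the source asserted)] -/
theorem Prop3_6_2_holds : Prop3_6_2 n k := by
  intro _
  set I := Ideal.span (primaryFamily n k)
  constructor
  · intro b₁ b₂ h
    simp only [AlgHom.comp_apply, Ideal.Quotient.mkₐ_eq_mk] at h
    rw [Ideal.Quotient.eq] at h
    have hker := span_primaryFamily_le_ker (n := n) k h
    rw [RingHom.mem_ker, map_sub, sub_eq_zero] at hker
    change chartParam n k (basicIncl n k b₁) = chartParam n k (basicIncl n k b₂) at hker
    rwa [chartParam_basicIncl, chartParam_basicIncl] at hker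
  · intro q
    obtain ⟨f, rfl⟩ := Ideal.Quotient.mkₐ_surjective k I q
    refine ⟨chartParam n k f, ?_⟩
    simp only [AlgHom.comp_apply, Ideal.Quotient.mkₐ_eq_mk]
    rw [Ideal.Quotient.eq, ← Ideal.neg_mem_iff, neg_sub]
    exact sub_incl_chartParam_mem k f

/-- **`Prop3_6_1` HOLDS** (first sentence of Prop 3.6 as typed, ring-level reading): `ker chartParam = (𝓕_m)`.
[cite: Hu2025, Prop. 3.6, p.38 l.11–19 (unrefereed preprint arXiv:2507.21400v1 under adjudication, D-0012/D-0089
— kernel support on OUR typed carriers of row 101; nothing of the source asserted)] -/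
theorem Prop3_6_1_holds : Prop3_6_1 n k := by
  intro _
  refine le_antisymm ?_ (span_primaryFamily_le_ker k)
  intro f hf
  rw [RingHom.mem_ker] at hf
  change chartParam n k f = 0 at hf
  have h := sub_incl_chartParam_mem (n := n) k f
  rwa [hf, map_zero, sub_zero] at h

/-- **`Prop3_6` HOLDS** as typed (both sentences).
[cite: Hu2025, Prop. 3.6, p.38 l.11–19 (unrefereed preprint arXiv:2507.21400v1 under adjudication, D-0012/D-0089
— kernel support on OUR typed carriers of row 101; nothing of the source asserted)] -/
theorem Prop3_6_holds : Prop3_6 n k := ⟨Prop3_6_1_holds k, Prop3_6_2_holds k⟩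

end Literature.AlgebraicGeometry.Hu2025.Statements.S03Pluecker

end
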